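import Summits.Langlands.Langlands.Theorems.PicardMuOrdinaryMuOrdinaryFamilyRTThornePAIResidualPoint
import Summits.Langlands.Langlands.Theorems.PicardMuOrdinaryMuOrdinaryFamilyRTThorneCompanionsReduction
import HarnessLib

/-!
# Crux `MuOrdinaryFamilyRT` (stmt-Langlands-13757), line `thorne-minimal-lift`:
# PA-I glue H6 = G10 — the COMPANION has the residual representation of the point over `L` after the
# residually trivial twist, and is irreducible there, tower form (PROVED)

Glue `residual_irreducible_twist_companion_tower` (registered) for `stub_thorneInputOverL`.  Thorne's minimal
automorphy lifting theorem (`Thorne2017.automorphyLifting_unitary_ordinaryMinimal`) is applied over a soluble CM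
extension `L ⊇ F' ⊇ K = ℚ(ζ₃)` to the pair `ρ = ((ρ_y|Γ_{F'}) ⊗ θ)|Γ_L`, `r = (r_c ⊗ θ)|Γ_L`, where
`ρ_y = y ∘ 𝓕.ρ` (`pointRep 𝓕 y`) is the point representation of a family `𝓕 : OrdFamily f ι e S₀ ρ_C` at an
integral `ℚ̄₃`-point `y`, `r_c : Γ_{F'} → GL₃(ℚ̄₃)` is its automorphic COMPANION — clause (d₃) of
`HasOrdinaryCompanion`: a frame `g` in which `g⁻¹ r_c g` is integral and ENTRYWISE CONGRUENT to `ρ_y|Γ_{F'}`,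
`‖(g⁻¹ r_c(σ) g)ᵢⱼ − (ρ_y(res σ))ᵢⱼ‖ < 1` — and `θ : Γ_{F'} → ℚ̄₃ˣ` is residually trivial (`‖θ σ − 1‖ < 1`).
Hypothesis (ii) of Thorne's theorem wants ONE `τ : Γ_L → GL₃(ℤ̄₃/𝔪)` which is a residual representation of
both; the sibling file …ThornePAIResidualPoint (H6' = G10') proves it for `ρ` with the natural

  `τ = GL₃(φ₃) ∘ r̄_f^B ∘ res_K^{F'} ∘ res_{F'}^L`,  `φ₃ = zmodToPadicAlgClResidueField 3`,

("tower form": no `Algebra K L` instance, the restriction to `Γ_K` is the composite of the chosen restriction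
maps), under the standing hypothesis that the heart keeps its image along the composite.  This file proves the
companion side:

* § 1 an integral FRAME gives an integral MODEL: if `g⁻¹ ρ(σ) g` has entries of norm `≤ 1` for all `σ`, then so
  does its inverse `g⁻¹ ρ(σ⁻¹) g`, so `σ ↦ g⁻¹ ρ(σ) g` factors through `GL₃(ℤ̄₃)` (`exists_monoidHom_map_eq`)
  and is an integral model of `ρ` in the frame `P = g`; two elements of `ℤ̄₃` at distance `< 1` have the same
  residue (`𝔪 = {‖x‖ < 1}`).
* § 2 the reduction of that integral model of `r_c` is `GL₃(φ₃) ∘ r̄ ∘ res_K^{F'}` ON THE NOSE: entrywise it has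
  the same residue as the identity-frame integral model `GL₃(y) ∘ 𝓕.ρ ∘ res_K^{F'}` of the point (clause (d₃)),
  whose reduction is computed in the sibling file (`integralReduction_pointRep_comp`: `y` is local and
  `𝓕.ρ mod π = r̄`).  Hence `r_c.IsReductionOf (RingHom.id _) (GL₃(φ₃) ∘ r̄ ∘ res_K^{F'})`, and — reductions
  compose with group homomorphisms — `(r_c|Γ_L).IsReductionOf (RingHom.id _) τ`.
* § 3 the registered statement.  When the heart keeps its image along `res_K^{F'} ∘ res_{F'}^L`, `τ` is
  absolutely irreducible (`isAbsIrreducible_rbar_comp`, …ThornePointAbsIrrRestrict, pushed along `φ₃`), so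
  (a) `τ` is its own semisimplification and a residual representation of `r_c|Γ_L`
  (`IsReductionOf.isResidualRepOf_of_isIrreducible`), hence of the twist `(r_c ⊗ θ)|Γ_L = (r_c|Γ_L) ⊗ (θ|Γ_L)`
  (`FramedGaloisRep.restrictField_twist`, `rfl`) by the residually trivial `θ|Γ_L`
  (`exists_padicAlgClIntegers_residue_eq_one_of_norm_sub_one_lt_one`, `FramedGaloisRep.isResidualRepOf_twist_iff`);
  (b) `r_c|Γ_L`, hence `(r_c ⊗ θ)|Γ_L` (`FramedGaloisRep.isResiduallyAbsIrreducible_twist_iff`), is residually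
  absolutely irreducible, so absolutely irreducible (`IsResiduallyAbsIrreducible.isAbsolutelyIrreducible`,
  Burnside) and in particular irreducible.

No definition, no named fact; the `𝔪_R`-adic continuity of `y` in the registered signature is not used (the
congruence (d₃) is already stated against `ρ_y`).
-/

set_option linter.dupNamespace false -- `Summit.Langlands.Langlands.…` is the problem's namespace

namespace Summit.Langlands.Langlands.Cruxes.MuOrdinaryFamilyRT.ThorneMinimalLift

open scoped NumberField Polynomial Matrix Classical
open Field IsDedekindDomain Polynomial IsLocalRing
open Literature.NumberTheory.GaloisRepresentations Literature.NumberTheory.Automorphic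
open Summit.Langlands.Langlands.Cruxes.MuOrdinaryFamilyRT.CharZeroDominance

noncomputable section

variable {f : ℤ[X]} {ι : PadicAlgCl 3 ≃+* ℂ} {e : K →+* ℂ} {S₀ : Finset (HeightOneSpectrum (𝓞 K))}
  {ρC : FramedGaloisRep K (PadicAlgCl 3) 3}

/-! ## 1. An integral frame gives an integral model; residues of congruent integers -/

/-- **An integral frame gives an integral model.**  If `ρ : Γ → GL_n(ℚ̄_ℓ)` is a homomorphism and `g` a frame
in which every `g⁻¹ ρ(σ) g` has entries of norm `≤ 1`, then `σ ↦ g⁻¹ ρ(σ) g` factors through a homomorphism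
`ρ₀ : Γ → GL_n(ℤ̄_ℓ)` (the inverse `g⁻¹ ρ(σ⁻¹) g` is integral too; `exists_monoidHom_map_eq`), an integral
model of `ρ` in the frame `P = g`. -/
theorem exists_integralModel_of_norm_le_one {ℓ : ℕ} [Fact ℓ.Prime] {Γ : Type*} [Group Γ] {n : ℕ}
    (ρ : Γ →* GL (Fin n) (PadicAlgCl ℓ)) (g : GL (Fin n) (PadicAlgCl ℓ))
    (hint : ∀ (σ : Γ) (i j : Fin n), ‖(g⁻¹ * ρ σ * g).val i j‖ ≤ 1) :
    ∃ ρ₀ : Γ →* GL (Fin n) (padicAlgClIntegers ℓ),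
      ∀ σ, Matrix.GeneralLinearGroup.map (padicAlgClIntegers ℓ).subtype (ρ₀ σ) = g⁻¹ * ρ σ * g := by
  -- adapted from `hasAbsolutelyIrreducibleReduction_iff_exists_span_eq_top` (Literature
  -- `AbsolutelyIrreducibleReduction`), frame `g ↝ g⁻¹`
  let φ : Γ →* GL (Fin n) (PadicAlgCl ℓ) := (MulAut.conj g⁻¹).toMonoidHom.comp ρ
  have hφ : ∀ σ, φ σ = g⁻¹ * ρ σ * g := fun σ => by simp [φ]
  have hmem : ∀ σ, φ σ ∈ (Matrix.GeneralLinearGroup.map (n := Fin n) (padicAlgClIntegers ℓ).subtype).range := by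
    intro σ
    rw [mem_range_generalLinearGroup_map_iff, hφ]
    refine ⟨fun i j => (padicAlgCl_mem_valuationSubring_iff ℓ _).2 (hint σ i j),
      fun i j => (padicAlgCl_mem_valuationSubring_iff ℓ _).2 ?_⟩
    have hinv : (g⁻¹ * ρ σ * g)⁻¹ = g⁻¹ * ρ σ⁻¹ * g := by rw [map_inv]; group
    rw [hinv]
    exact hint σ⁻¹ i j
  obtain ⟨ρ₀, hρ₀⟩ := exists_monoidHom_map_eq φ hmem
  exact ⟨ρ₀, fun σ => (hρ₀ σ).trans (hφ σ)⟩

/-- **Congruent integers have the same residue**: for `u, v ∈ ℤ̄_ℓ` with `‖u − v‖ < 1`, `u ≡ v (mod 𝔪)`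
(`𝔪 = {‖x‖ < 1}`, `mem_maximalIdeal_iff_norm_lt_one`). -/
theorem residue_eq_residue_of_norm_sub_lt_one {ℓ : ℕ} [Fact ℓ.Prime] {u v : padicAlgClIntegers ℓ}
    (h : ‖(u : PadicAlgCl ℓ) - (v : PadicAlgCl ℓ)‖ < 1) :
    residue (padicAlgClIntegers ℓ) u = residue (padicAlgClIntegers ℓ) v := by
  rw [← sub_eq_zero, ← map_sub, residue_eq_zero_iff,
    mem_maximalIdeal_iff_norm_lt_one (padicAlgCl_mem_valuationSubring_iff ℓ), AddSubgroupClass.coe_sub]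
  exact h

/-- Reductions compose with group homomorphisms: if `τ` is a reduction of `ρ` then `τ ∘ φ` is a reduction of
`ρ ∘ φ` (same lattice, same frames). -/
theorem isReductionOf_comp_hom {F : Type*} [Field F] {O : ValuationSubring F} {n : ℕ} {G H : Type*} [Group G]
    [Group H] {k : Type*} [Field k] {ι' : ResidueField O →+* k} {ρ : G →* GL (Fin n) F} {τ : G →* GL (Fin n) k}
    (h : IsReductionOf ι' ρ τ) (φ : H →* G) : IsReductionOf ι' (ρ.comp φ) (τ.comp φ) := by
  obtain ⟨ρ₀, Q, ⟨P, hP⟩, hQ⟩ := h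
  exact ⟨ρ₀.comp φ, Q, ⟨P, fun x => hP (φ x)⟩, fun x => hQ (φ x)⟩

/-- `GL_n(ψ) ∘ (GL_n(φ) ∘ σ) = GL_n(ψ ∘ φ) ∘ σ`. -/
theorem generalLinearGroup_map_comp_map_comp {G : Type*} [Group G] {n : ℕ} {k₁ k₂ k₃ : Type*} [CommRing k₁]
    [CommRing k₂] [CommRing k₃] (φ : k₁ →+* k₂) (ψ : k₂ →+* k₃) (σ : G →* GL (Fin n) k₁) :
    (Matrix.GeneralLinearGroup.map ψ).comp ((Matrix.GeneralLinearGroup.map φ).comp σ) =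
      (Matrix.GeneralLinearGroup.map (ψ.comp φ)).comp σ :=
  MonoidHom.ext fun _ => Units.ext (Matrix.ext fun _ _ => rfl)

/-- Absolute irreducibility of `σ : G → GL_n(k)` passes to `GL_n(φ) ∘ σ` for every field map `φ : k → k₂`
(the scalar extensions of the latter are among those of the former). -/
theorem isAbsIrreducible_map_comp {G : Type*} [Group G] {n : ℕ} {k k₂ : Type} [Field k] [Field k₂]
    {σ : G →* GL (Fin n) k} (h : IsAbsIrreducible σ) (φ : k →+* k₂) :
    IsAbsIrreducible ((Matrix.GeneralLinearGroup.map φ).comp σ) := fun k' _ ψ => by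
  rw [generalLinearGroup_map_comp_map_comp]
  exact h k' (ψ.comp φ)

/-! ## 2. The reduction of the companion's integral model -/

/-- **The companion reduces to `GL₃(φ₃) ∘ r̄ ∘ res_K^{F'}` on the nose.**  Let `y` be an integral point,
`r_c : Γ_{F'} → GL₃(ℚ̄₃)` and `g` a frame with `g⁻¹ r_c(σ) g` integral and entrywise congruent to
`ρ_y(res_K^{F'} σ)` (clause (d₃) of `HasOrdinaryCompanion`).  Then for every `φ₃ : 𝔽₃ → ℤ̄₃/𝔪`,
`GL₃(φ₃) ∘ r̄_f^B ∘ res_K^{F'}` is a reduction of `r_c` (frames `P = g`, `Q = 1`): the integral model of § 1 has,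
entry by entry, the same residues as the identity-frame integral model `GL₃(y) ∘ 𝓕.ρ ∘ res_K^{F'}` of the point,
whose reduction is `GL₃(φ₃) ∘ r̄ ∘ res_K^{F'}` (`integralReduction_pointRep_comp`). -/
theorem isReductionOf_companion (𝓕 : OrdFamily f ι e S₀ ρC) (y : 𝓕.R →+* PadicAlgCl 3)
    (hy : ∀ r : 𝓕.R, ‖y r‖ ≤ 1) {F' : Type*} [Field F'] [Algebra K F']
    (rc : FramedGaloisRep F' (PadicAlgCl 3) 3) (g : GL (Fin 3) (PadicAlgCl 3))
    (hg : ∀ (σ : absoluteGaloisGroup F') (i j : Fin 3), ‖(g⁻¹ * rc σ * g).val i j‖ ≤ 1 ∧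
      ‖(g⁻¹ * rc σ * g).val i j - (pointRep 𝓕 y (absGaloisRestrict K F' σ)).val i j‖ < 1)
    (φ₃ : ZMod 3 →+* padicAlgClResidueField 3) :
    rc.IsReductionOf (RingHom.id _)
      ((Matrix.GeneralLinearGroup.map φ₃).comp ((rbar f 𝓕.B).comp (absGaloisRestrict K F').toMonoidHom)) := by
  obtain ⟨ρ₀, hρ₀⟩ :=
    exists_integralModel_of_norm_le_one (rc : absoluteGaloisGroup F' →* GL (Fin 3) (PadicAlgCl 3)) g
      fun σ i j => (hg σ i j).1
  refine ⟨ρ₀, 1, ⟨g, hρ₀⟩, fun σ => ?_⟩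
  rw [one_mul, inv_one, mul_one, ← integralReduction_pointRep_comp 𝓕 y hy (absGaloisRestrict K F') φ₃ σ]
  refine Units.ext (Matrix.ext fun i j => ?_)
  rw [integralReduction_apply_coe, integralReduction_apply_coe, RingHom.id_apply, RingHom.id_apply]
  refine (residue_eq_residue_of_norm_sub_lt_one ?_).symm
  rw [← FramedRep.coe_apply_eq_of_map_eq (hρ₀ σ) i j]
  have h2 : ((((Matrix.GeneralLinearGroup.map
        (y.codRestrict (padicAlgClIntegers 3) (point_mem_padicAlgClIntegers 𝓕 y hy))).comp
          (𝓕.ρ.comp (absGaloisRestrict K F').toMonoidHom) σ : GL (Fin 3) (padicAlgClIntegers 3)) :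
            Matrix (Fin 3) (Fin 3) (padicAlgClIntegers 3)) i j : PadicAlgCl 3) =
      (pointRep 𝓕 y (absGaloisRestrict K F' σ)).val i j := by
    rw [pointRep_val_apply]
    rfl
  rw [h2]
  exact (hg σ i j).2

/-- **Tower form.**  Under the same hypotheses, for every further extension `L/F'`,
`τ = GL₃(φ₃) ∘ r̄_f^B ∘ res_K^{F'} ∘ res_{F'}^L` is a reduction of `r_c|Γ_L` (reductions compose with
`res_{F'}^L`). -/
theorem isReductionOf_companion_tower (𝓕 : OrdFamily f ι e S₀ ρC) (y : 𝓕.R →+* PadicAlgCl 3)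
    (hy : ∀ r : 𝓕.R, ‖y r‖ ≤ 1) {F' : Type*} [Field F'] [Algebra K F'] (L : Type*) [Field L] [Algebra F' L]
    (rc : FramedGaloisRep F' (PadicAlgCl 3) 3) (g : GL (Fin 3) (PadicAlgCl 3))
    (hg : ∀ (σ : absoluteGaloisGroup F') (i j : Fin 3), ‖(g⁻¹ * rc σ * g).val i j‖ ≤ 1 ∧
      ‖(g⁻¹ * rc σ * g).val i j - (pointRep 𝓕 y (absGaloisRestrict K F' σ)).val i j‖ < 1)
    (φ₃ : ZMod 3 →+* padicAlgClResidueField 3) :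
    (rc.restrictField L).IsReductionOf (RingHom.id _)
      ((Matrix.GeneralLinearGroup.map φ₃).comp
        (((rbar f 𝓕.B).comp (absGaloisRestrict K F').toMonoidHom).comp (absGaloisRestrict F' L).toMonoidHom)) :=
  isReductionOf_comp_hom (isReductionOf_companion 𝓕 y hy rc g hg φ₃) (absGaloisRestrict F' L).toMonoidHom

/-! ## 3. The registered glue H6 = G10 -/

/-- **H6 = G10 `residual_irreducible_twist_companion_tower` (registered PA-I glue, PROVED).**  For generic `f`, a
family `𝓕`, number fields `F' ⊇ K` and `L ⊇ F'` such that the heart keeps its image along the composite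
restriction `res_K^{F'} ∘ res_{F'}^L`, an integral `ℚ̄₃`-point `y` of `𝓕.R`, a representation
`r_c : Γ_{F'} → GL₃(ℚ̄₃)` admitting a frame `g` with `g⁻¹ r_c g` integral and entrywise congruent to
`ρ_y|Γ_{F'}` (clause (d₃) of `HasOrdinaryCompanion`), and a character `θ : Γ_{F'} → ℚ̄₃ˣ` with `‖θ σ − 1‖ < 1`:
`τ = GL₃(φ₃) ∘ r̄_f^B ∘ res_K^{F'} ∘ res_{F'}^L` (`φ₃ = zmodToPadicAlgClResidueField 3`) is a residual
representation of `(r_c ⊗ θ)|Γ_L` along `RingHom.id (ℤ̄₃/𝔪)`, and `(r_c ⊗ θ)|Γ_L` is irreducible — the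
companion half of hypothesis (ii) and the irreducibility input of
`Thorne2017.automorphyLifting_unitary_ordinaryMinimal` for `F = L`, `p = 3`.  Proof: § 1–§ 2, the module
docstring's § 3. -/
theorem residual_irreducible_twist_companion_tower : ∀ (f : ℤ[X]) (ι : PadicAlgCl 3 ≃+* ℂ) (e : K →+* ℂ) (S₀ : Finset (HeightOneSpectrum (𝓞 K))) (ρC : FramedGaloisRep K (PadicAlgCl 3) 3) (𝓕 : OrdFamily f ι e S₀ ρC), Generic f → ∀ (F' : Type) [Field F'] [NumberField F'] [Algebra K F'] (L : Type) [Field L] [NumberField L] [Algebra F' L], (((rbar f 𝓕.B).comp (absGaloisRestrict K F').toMonoidHom).comp (absGaloisRestrict F' L).toMonoidHom).range = (rbar f 𝓕.B).range → ∀ (y : 𝓕.R →+* PadicAlgCl 3), (∀ N : ℕ, ∃ M : ℕ, ∀ r ∈ IsLocalRing.maximalIdeal 𝓕.R ^ M, ‖y r‖ ≤ ((3 : ℝ)⁻¹) ^ N) → (∀ r : 𝓕.R, ‖y r‖ ≤ 1) → ∀ (rc : FramedGaloisRep F' (PadicAlgCl 3) 3), (∃ g : GL (Fin 3) (PadicAlgCl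 3), ∀ (σ : absoluteGaloisGroup F') (i j : Fin 3), ‖(g⁻¹ * rc σ * g).val i j‖ ≤ 1 ∧ ‖(g⁻¹ * rc σ * g).val i j - (pointRep 𝓕 y (absGaloisRestrict K F' σ)).val i j‖ < 1) → ∀ (θ : absoluteGaloisGroup F' →ₜ* (PadicAlgCl 3)ˣ), (∀ σ : absoluteGaloisGroup F', ‖((θ σ : (PadicAlgCl 3)ˣ) : PadicAlgCl 3) - 1‖ < 1) → (FramedGaloisRep.restrictField L (rc.twist θ)).IsResidualRepOf (RingHom.id _) ((Matrix.GeneralLinearGroup.map (zmodToPadicAlgClResidueField 3)).comp (((rbar f 𝓕.B).comp (absGaloisRestrict K F').toMonoidHom).comp (absGaloisRestrict F' L).toMonoidHom)) ∧ (FramedGaloisRep.restrictField L (rc.twist θ)).toGaloisRep.IsIrreducible := by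
  intro f ι e S₀ ρC 𝓕 hgen F' _ _ _ L _ _ _ hL y _ hy rc hrc θ hθ
  obtain ⟨g, hg⟩ := hrc
  -- the composite restriction `φ = res_K^{F'} ∘ res_{F'}^L` keeps the image of the heart
  set φ : absoluteGaloisGroup L →ₜ* absoluteGaloisGroup K :=
    (absGaloisRestrict K F').comp (absGaloisRestrict F' L)
  have hφm :
      ((rbar f 𝓕.B).comp (absGaloisRestrict K F').toMonoidHom).comp (absGaloisRestrict F' L).toMonoidHom =
        (rbar f 𝓕.B).comp φ.toMonoidHom := rfl
  have hkeep : (rbar f 𝓕.B).range ≤ ((rbar f 𝓕.B).comp φ.toMonoidHom).range :=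
    (range_comp_eq_iff _ _).1 (by rw [← hφm]; exact hL)
  -- `τ` is a reduction of `r_c|Γ_L`, and is absolutely irreducible
  have hred := isReductionOf_companion_tower 𝓕 y hy L rc g hg (zmodToPadicAlgClResidueField 3)
  have habsτ : IsAbsIrreducible ((Matrix.GeneralLinearGroup.map (zmodToPadicAlgClResidueField 3)).comp
      (((rbar f 𝓕.B).comp (absGaloisRestrict K F').toMonoidHom).comp (absGaloisRestrict F' L).toMonoidHom)) := by
    rw [hφm]
    exact isAbsIrreducible_map_comp (isAbsIrreducible_rbar_comp hgen 𝓕.B φ.toMonoidHom hkeep) _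
  -- `θ|Γ_L` is residually trivial, and `(r_c ⊗ θ)|Γ_L = (r_c|Γ_L) ⊗ (θ|Γ_L)`
  have hχ := exists_padicAlgClIntegers_residue_eq_one_of_norm_sub_one_lt_one
    (θ.comp (absGaloisRestrict F' L)) fun σ => hθ (absGaloisRestrict F' L σ)
  rw [FramedGaloisRep.restrictField_twist]
  refine ⟨?_, ?_⟩
  · -- (a) residual representation: untwist, then § 2 and irreducibility of `τ`
    exact (FramedGaloisRep.isResidualRepOf_twist_iff hχ).2
      (hred.isResidualRepOf_of_isIrreducible (habsτ _ (RingHom.id _)))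
  · -- (b) irreducibility: residually absolutely irreducible ⟹ absolutely irreducible ⟹ irreducible
    have hres : FramedGaloisRep.IsResiduallyAbsIrreducible
        (FramedRep.twist (rc.restrictField L) (θ.comp (absGaloisRestrict F' L))) :=
      (FramedGaloisRep.isResiduallyAbsIrreducible_twist_iff hχ).2 ⟨_, hred, habsτ⟩
    exact (FramedGaloisRep.IsResiduallyAbsIrreducible.isAbsolutelyIrreducible (by norm_num) hres).isIrreducible

end

end Summit.Langlands.Langlands.Cruxes.MuOrdinaryFamilyRT.ThorneMinimalLift
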